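import Summits.CriticalPhenomena.PercolationContinuityZ3.Theorems.PercNearOneGluingNoHeavyQuantSliceClosureRefutation
import Summits.CriticalPhenomena.PercolationContinuityZ3.Theorems.PercNearOneGluingNoHeavyQuantSliceClosureBlobs
import HarnessLib

/-!
# QUANT lane R8, T-DEC: after the refutation of Conjecture SL — the ALL-LAYERS slice closure `LawDec.SliceClosedAll` (the statement the
# lane's inductions actually use) and the reductions BLOB-DEC(k) ∀ k ⟸ `SliceClosedAll`

builds on p205010 (kernel theorem, internal audit signed; external expert review pending)

Statement + support file (`--supports stmt-CriticalPhenomena-4575`), QUANT lane seat prim-quant-census-2 (gen 54), rung R8 of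
`run/shared/lean/prim/quant/LADDER.md`.  Memo `run/shared/lean/prim/quant/prim-quant-census-2-g54/SL-STRUCTURE-G54.md` §2.  One `@[conjecture]`,
theorems with standard axioms, no sorries.  Continues `…QuantSliceClosure` (g53: `slice`, `blobLaw`, the refuted `SliceClosed`, `blobDEC_of_sliceClosed`),
`…QuantSliceClosureBlobs` (`blobLawOn`, `exists_blobLaw_eq`) and `…QuantSliceClosureRefutation` (g54: `not_sliceClosed`).

WHY.  `LawDec.SliceClosed` asked for DEC of the law at the two layers `j′` and `j′ − a` only and is FALSE (`not_sliceClosed`: the witness law fails DEC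
at the layers in between, and exactly those layers price the light straddlers — memo §2).  But every place the lane USES slice closure (the induction
`blobDEC_of_sliceClosed` for BLOB-DEC(k), the tree-built / SDEC chain) slices a law that is DEC at EVERY layer: that is the induction hypothesis.  So the
statement of record becomes the all-layers closure below; g53's induction transfers verbatim.

* **`LawDec.SliceClosedAll`** (`@[conjecture]`) — for a top-affordable law `μ ≥ 0` on `{0..M}` of mass `1`, a blob `(a ≥ 1, x ≤ g < 1)`, `0 < x`: if `μ` is
  DEC(i) at floor `x` (at its mean) for EVERY layer `i`, then `slice μ a g` is DEC(j′) for every layer `j′ < M + a`.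
  EVIDENCE (exact LP, census-2 g54; even with the hypothesis only at the WINDOW layers `[j′−a, j′]`): the aimed cell-LP maximisation that produces two-layer
  counterexamples at will (8 / 8 structures) finds NONE — 0 / ≈ 2 900 cells (counterexample geometry 257 + 597 tight, shallow-low/band-above 331, `j′ ≥ M` 186,
  no top-affordability 100, small floors 248, 5–8-atom supports 503, kit j138928/9 3 558) and 0 / ≈ 25 000 direct laws × layers (bimodal/blob/tree/random incl. kit
  j138928/9 21 837; tree laws at their largest all-layer floor 390); kit j138136–9 / j139232 (all-layers cells + direct sampling) attached to stmt-CriticalPhenomena-4575.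
  The counterexample family regains slice-DEC exactly when the law regains all-layer DEC; g53's censuses (1.09 M layers / 0) only ever sliced all-layer-DEC laws.  KNOWN: layers `j′ < a` (criterion E, `slice_decAt_of_lt`), data without light straddlers at layer `j′`
  (`slice_decAtT_of_bdecAtT'`, typer g23), gate `1` (`sliceClosedT_gate_one`).  OPEN: light straddlers (the intermediate layer `J = w` for each band
  atom `w` / `J = m − 1` for each straddler mid `m` is what the dual split consumes — memo §2).
* **`LawDec.sliceClosedAll_of_forall`** — the all-layers CONCLUSION: under `SliceClosedAll`, a top-affordable all-layer-DEC law has an all-layer-DEC slice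
  (layers `≥ M + a` by Theorem A `decAt_of_top_le`, using the slice's top-affordability `x·(M+a) ≤ mean + a·g`).
* **`LawDec.blobDEC_of_sliceClosedAll`**, **`blobDEC_on_of_sliceClosedAll`** — BLOB-DEC(k) for every `k` (list form and product-Bernoulli form) from
  `SliceClosedAll`, by g53's induction on the blob list (`decAt_blobLaw_nil`, `sum_blobLaw`, `sum_mul_blobLaw`, `floor_mul_blobTop_le`).
HONEST: `SliceClosedAll`, BLOB-DEC(k ≥ 3), `TreeBuiltDEC`, `SDECConvClosed`, `Quant.TreeDEC`, `FarTreeRow` are OPEN; `SliceClosed`, `SliceClosedT` are FALSE.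

[this work]; DEC rules ARCH-TREES-G49 §2.2 / DEC-TAMP-G50 §3.1, memos DEC-CLOSURE-G53, SL-STRUCTURE-G54 (this lane).  The gluing rows served
[cite: KozmaNitzan2024, Conjecture 3 (p. 15)]; product measure [cite: Grimmett1999, §1.3 p. 10].
-/

noncomputable section

namespace Summit.CriticalPhenomena.PercolationContinuityZ3.Theorems

namespace Quant

open Finset

namespace LawDec

/-! ### The all-layers conjecture -/

/-- **CONJECTURE SL-ALL (all-layers slice closure of DEC; census-2 g54, replacing the refuted `LawDec.SliceClosed`).**  For a law `μ ≥ 0` on `{0..M}`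
(mass `1`) that is top-affordable at floor `0 < x` (`x·h ≤ mean` for charged `h`), a blob size `a ≥ 1`, a gate `x ≤ g < 1` and a layer `j′ < M + a`:
if `μ` is DEC(i) at floor `x` (`LawDec.DECAt`, at its mean) for EVERY layer `i`, then the slice `LawDec.slice μ a g` is DEC(j′).
(`not_sliceClosed`: the two layers `j′`, `j′−a` alone do NOT suffice.)  EVIDENCE: see the file header. [this work] [status: open] -/
@[conjecture] def SliceClosedAll : Prop :=
  ∀ (x g : ℝ) (M a j' : ℕ) (μ : ℕ → ℝ),
    0 < x → x ≤ g → g < 1 → 1 ≤ a →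
    (∀ h, 0 ≤ μ h) → (∀ h, M < h → μ h = 0) → (∑ h ∈ Finset.range (M + 1), μ h = 1) →
    (∀ h, 0 < μ h → x * (h : ℝ) ≤ ∑ k ∈ Finset.range (M + 1), (k : ℝ) * μ k) →
    j' < M + a →
    (∀ i, DECAt x i M μ) →
    DECAt x j' (M + a) (slice μ a g)

/-! ### The all-layers conclusion -/

/-- **under SL-ALL the slice is again DEC at EVERY layer** (layers `≥ M + a`: Theorem A — the slice is top-affordable because `μ` is and `x ≤ g`).
[this work] -/
theorem sliceClosedAll_of_forall (hSL : SliceClosedAll) (x g : ℝ) (M a : ℕ) (μ : ℕ → ℝ)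
    (hx0 : 0 < x) (hxg : x ≤ g) (hg1 : g < 1) (ha : 1 ≤ a)
    (hμ0 : ∀ h, 0 ≤ μ h) (hμM : ∀ h, M < h → μ h = 0) (hμ1 : ∑ h ∈ Finset.range (M + 1), μ h = 1)
    (htop : ∀ h, 0 < μ h → x * (h : ℝ) ≤ ∑ k ∈ Finset.range (M + 1), (k : ℝ) * μ k)
    (hdec : ∀ i, DECAt x i M μ) (j' : ℕ) :
    DECAt x j' (M + a) (slice μ a g) := by
  by_cases hj : j' < M + a
  · exact hSL x g M a j' μ hx0 hxg hg1 ha hμ0 hμM hμ1 htop hj hdec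
  · -- Theorem A for the slice: it is top-affordable
    have hx1 : x < 1 := lt_of_le_of_lt hxg hg1
    have hg0 : 0 ≤ g := hx0.le.trans hxg
    have hs0 : ∀ h, 0 ≤ slice μ a g h := slice_nonneg μ a g hg0 hg1.le hμ0
    have hsM : ∀ h, M + a < h → slice μ a g h = 0 := fun h hh => slice_eq_zero μ a g M hμM h hh
    have hs1 := sum_slice μ a g M hμM hμ1
    refine decAt_of_top_le (M + a) (slice μ a g) hs0 hsM hs1 x hx1 (fun h hh => ?_) j' (not_lt.1 hj)
    rw [sum_mul_slice μ a g M hμM hμ1]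
    -- a charged atom of the slice is `≤ M + a`, and `x·(M + a) ≤ mean μ + a·g` since `x·M ≤ mean μ` (some atom `≤ M`... via the top atom) and `x ≤ g`
    have hle : h ≤ M + a := by
      by_contra hlt
      exact absurd (hsM h (not_le.1 hlt)) (ne_of_gt hh)
    -- `x * M ≤ mean`: the charged atom `h` of the slice comes from a charged atom `k` of `μ` with `k ≥ h - a`; use it
    have hcharged : ∃ k, 0 < μ k ∧ h ≤ k + a := by
      simp only [slice] at hh
      by_cases hk : 0 < μ h
      · exact ⟨h, hk, Nat.le_add_right h a⟩
      · have hμh : μ h = 0 := le_antisymm (not_lt.1 hk) (hμ0 h)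
        rw [hμh, mul_zero, zero_add] at hh
        by_cases hah : a ≤ h
        · rw [if_pos hah] at hh
          have : 0 < μ (h - a) := by
            by_contra hz
            have hz' : μ (h - a) = 0 := le_antisymm (not_lt.1 hz) (hμ0 _)
            rw [hz', mul_zero] at hh
            exact lt_irrefl _ hh
          exact ⟨h - a, this, by omega⟩
        · rw [if_neg hah, mul_zero] at hh
          exact absurd hh (lt_irrefl _)
    obtain ⟨k, hk, hhk⟩ := hcharged
    have h1 := htop k hk
    have h2 : (h : ℝ) ≤ k + a := by exact_mod_cast hhk
    have h3 : x * (a : ℝ) ≤ (a : ℝ) * g := by rw [mul_comm]; exact mul_le_mul_of_nonneg_left hxg (Nat.cast_nonneg a)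
    nlinarith [hx0.le, h1, h2, h3]

/-! ### BLOB-DEC(k) for every k from SL-ALL -/

/-- **BLOB-DEC(k) FOR EVERY k FROM `SliceClosedAll`** (g53's induction `blobDEC_of_sliceClosed` with the all-layers hypothesis, which is exactly its
induction hypothesis): for every floor `0 < x` and every finite list of blobs with sizes `≥ 1` and gates in `[x, 1)`, the blob law is DEC(j′) at floor
`x` for EVERY layer `j′`. [this work] -/
theorem blobDEC_of_sliceClosedAll (hSL : SliceClosedAll) (x : ℝ) (hx0 : 0 < x) :
    ∀ (l : List (ℕ × ℝ)), (∀ p ∈ l, 1 ≤ p.1 ∧ x ≤ p.2 ∧ p.2 < 1) → ∀ j', DECAt x j' (blobTop l) (blobLaw l) := by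
  intro l
  induction l with
  | nil => exact fun _ j' => decAt_blobLaw_nil x j'
  | cons p l ih =>
    intro hl j'
    have hp := hl p (by simp)
    have hl' : ∀ q ∈ l, 1 ≤ q.1 ∧ x ≤ q.2 ∧ q.2 < 1 := fun q hq => hl q (by simp [hq])
    have ih' := ih hl'
    have hgates : ∀ q ∈ l, 0 ≤ q.2 ∧ q.2 ≤ 1 := fun q hq => ⟨hx0.le.trans (hl' q hq).2.1, (hl' q hq).2.2.le⟩
    -- top-affordability of the tail law
    have htop : ∀ h, 0 < blobLaw l h → x * (h : ℝ) ≤ ∑ k ∈ Finset.range (blobTop l + 1), (k : ℝ) * blobLaw l k := by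
      intro h hh
      rw [sum_mul_blobLaw]
      have hle : h ≤ blobTop l := by
        by_contra hlt
        exact absurd (blobLaw_eq_zero l h (not_le.1 hlt)) (ne_of_gt hh)
      have := floor_mul_blobTop_le x l (fun q hq => (hl' q hq).2.1)
      have hxh : x * (h : ℝ) ≤ x * (blobTop l : ℝ) := mul_le_mul_of_nonneg_left (by exact_mod_cast hle) hx0.le
      linarith
    exact sliceClosedAll_of_forall hSL x p.2 (blobTop l) p.1 (blobLaw l) hx0 hp.2.1 hp.2.2 hp.1 (blobLaw_nonneg l hgates)
      (fun h hh => blobLaw_eq_zero l h hh) (sum_blobLaw l) htop ih' j'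

/-- **BLOB-DEC(k) FOR EVERY k, PRODUCT-BERNOULLI FORM, FROM `SliceClosedAll`.**  For `0 < x` and blobs `i ∈ s` with sizes `a i ≥ 1` and gates
`x ≤ p i < 1`, the count law `blobLawOn s a p` is DEC(j′) at floor `x` for every layer `j′`. [this work] -/
theorem blobDEC_on_of_sliceClosedAll {ι : Type*} [DecidableEq ι] (hSL : SliceClosedAll) (x : ℝ) (hx0 : 0 < x)
    (s : Finset ι) (a : ι → ℕ) (p : ι → ℝ)
    (hs : ∀ i ∈ s, 1 ≤ a i ∧ x ≤ p i ∧ p i < 1) (j' : ℕ) :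
    DECAt x j' (∑ i ∈ s, a i) (blobLawOn s a p) := by
  obtain ⟨l, hl, hlaw, htop⟩ := exists_blobLaw_eq s a p
  rw [← hlaw, ← htop]
  refine blobDEC_of_sliceClosedAll hSL x hx0 l (fun q hq => ?_) j'
  obtain ⟨i, his, e⟩ := hl q hq
  rw [e]
  exact hs i his

/-! ### Step A of the two-step architecture: a law that is a mixture of SLICEABLE components has a DEC slice -/

/-- the slice is linear: the slice of a finite mixture is the mixture of the slices. [this work] -/
theorem slice_mixture {ι : Type} [Fintype ι] (w : ι → ℝ) (ν : ι → ℕ → ℝ) (a : ℕ) (g : ℝ) (h : ℕ) :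
    slice (fun t => ∑ i, w i * ν i t) a g h = ∑ i, w i * slice (ν i) a g h := by
  simp only [slice]
  split_ifs with ha
  · rw [Finset.mul_sum, Finset.mul_sum, ← Finset.sum_add_distrib]
    refine Finset.sum_congr rfl fun i _ => by ring
  · rw [mul_zero, add_zero, Finset.mul_sum]
    refine Finset.sum_congr rfl fun i _ => by ring

/-- **STEP A (memo SL-STRUCTURE-G54 §2c): if `μ` is a finite mixture of laws whose slices are DEC at `(x, T′, j′)` on `{0..M+a}`, then so is the
slice of `μ`.**  With two-point components this is the "sliceable decomposition" route: points, deep pairs (heavy: `slice_heavyPair_decAtT`;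
light: `LightTwoBlobDEC`), giant pairs (`slice_giant_decAtT`) and window pairs at a large enough gate are sliceable.  CAUTION (kit j138928): this
component-wise route is only SUFFICIENT — 1 law in ≈ 22 000 window-DEC laws has a DEC slice without being a mixture of sliceable TWO-POINT components
(the slice pools absorber mass across pieces); the statement to prove remains `SliceClosedAll` itself (or `LawDec.SliceDominated`). [this work] -/
theorem slice_decAtT_of_components {ι : Type} [Fintype ι] (x T' g : ℝ) (j' M a : ℕ) (μ : ℕ → ℝ) (w : ι → ℝ) (ν : ι → ℕ → ℝ)
    (hw0 : ∀ i, 0 ≤ w i) (hw1 : ∑ i, w i = 1) (hμ : ∀ h, μ h = ∑ i, w i * ν i h)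
    (hdec : ∀ i, 0 < w i → DECAtT x T' j' (M + a) (slice (ν i) a g)) :
    DECAtT x T' j' (M + a) (slice μ a g) := by
  have e : slice μ a g = slice (fun t => ∑ i, w i * ν i t) a g := by
    congr 1; funext t; exact hμ t
  rw [e]
  exact decAtT_finite_mixture x T' j' (M + a) _ w (fun i => slice (ν i) a g) hw0 hw1 (fun h => slice_mixture w ν a g h) hdec

end LawDec

end Quant

end Summit.CriticalPhenomena.PercolationContinuityZ3.Theorems
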